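import Literature.MathematicalPhysics.QuantumLattice.GrassmannCumulantBoundDB
import HarnessLib

/-!
# The BI-GRADED order-`n` bound for the truncated expectations: `2p` external legs need `p - 1` vertices of degree `4`

Topic `MathematicalPhysics/QuantumLattice`; companion of `GrassmannCumulantBoundDB` (`sum_norm_kernel_cumulantOf_le_of_gramBounded`:
the pinned `L¹` norm of the degree-`r` kernel of `𝓔ᵀ_C(V; n)` is a sum over degree assignments `δ : Fin n → degs` carrying the
degree indicator `[r + 2(n-1) ≤ Σ_a 2δ_a]`, and `…_le_pow_of_gramBounded`, which drops the indicator and sums to `‖V‖_hⁿ`).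
Here the indicator is KEPT for an interaction whose kernels live in degrees `≤ 4` (pinned norms `N(m')`, `N(m') = 0` for
`m' > 2`): an assignment with all `δ_a ≤ 2` and `q` entries equal to `2` has `Σ_a 2δ_a ≤ 2n + 2q`, so in output degree
`r = 2p` only assignments with `q ≥ p - 1` QUARTIC vertices contribute (Benfatto–Giuliani–Mastropietro 2006, (2.13)–(2.14):
quadratic vertices do not raise the number of external legs), and

  `Σ_{W : W_i = w} ‖kernel_{2p} 𝓔ᵀ_C(V; n)(W)‖ ≤ n!·ρ^{-2p} κ^{-2(n-1)} α^{n-1} eⁿ · C(n, p-1) · f₂^{p-1} · ‖V‖_h^{n-p+1}`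

(**`sum_norm_kernel_cumulantOf_le_biquartic_of_gramBounded`**), `f₂ = (e²(κ+ρ))⁴ N(2)` the quartic part of
`‖V‖_h = Σ_{m'} (e²(κ+ρ))^{2m'} N(m')` — in place of `‖V‖_hⁿ`.  Summed over `n` (next file) this gives the degree-`2p` kernels of
the effective action the size `e f₂ θ₂^{p-2}/(1-θ)^p`, `θ₂ = eαf₂/κ²`: of order `p - 1` in the QUARTIC coupling whatever the size of
the quadratic part (a counterterm).

* `sum_two_mul_le_of_le_two` — `Σ_a 2δ_a ≤ 2n + 2·#{a : δ_a = 2}` when all `δ_a ≤ 2`;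
* `sum_piFinset_indicator_prod_le_choose` — `Σ_δ [k ≤ #{δ_a = 2}] ∏_a f(δ_a) ≤ C(n,k) f(2)^k (Σ f)^{n-k}` (`f ≥ 0`);
* **`sum_norm_kernel_cumulantOf_le_biquartic_of_gramBounded`**.

## Sources

G. Benfatto, A. Giuliani, V. Mastropietro, Ann. Henri Poincaré 7 (2006) 809–898, (2.13)–(2.14), (2.77)–(2.80)
[`BenfattoGiulianiMastropietro2006`]; K. Gawȩdzki, A. Kupiainen, Comm. Math. Phys. 102 (1985) 1–30, §3 [`GawedzkiKupiainen1985`].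
-/

noncomputable section

universe u

namespace Literature.MathematicalPhysics.QuantumLattice

open GrassmannAlgebra Finset MvPolynomial Literature.RingTheory.MvPolynomial
open Literature.Probability.LatticeModels Literature.Probability.LatticeModels.BattleFederbush
open Literature.MeasureTheory.Integral
open scoped InnerProductSpace

/-! ### §1 Counting quartic entries -/

/-- If all `δ_a ≤ 2` then `Σ_a 2δ_a ≤ 2n + 2·#{a : δ_a = 2}`. [folklore] -/
private theorem sum_two_mul_le_of_le_two {n : ℕ} (δ : Fin n → ℕ) (hδ : ∀ a, δ a ≤ 2) :
    ∑ a, 2 * δ a ≤ 2 * n + 2 * (univ.filter fun a => δ a = 2).card := by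
  have h : ∀ a ∈ (univ : Finset (Fin n)), 2 * δ a ≤ 2 + 2 * (if δ a = 2 then 1 else 0) := by
    intro a _
    have := hδ a
    split_ifs with h2 <;> omega
  calc ∑ a, 2 * δ a ≤ ∑ a : Fin n, (2 + 2 * (if δ a = 2 then 1 else 0)) := sum_le_sum h
    _ = 2 * n + 2 * (univ.filter fun a => δ a = 2).card := by
        rw [sum_add_distrib, sum_const, card_univ, Fintype.card_fin, ← mul_sum, sum_boole, smul_eq_mul, mul_comm n 2]
        rfl

/-- **`Σ_δ [k ≤ #{a : δ_a = 2}] ∏_a f(δ_a) ≤ C(n,k)·f(2)^k·(Σ_{m'} f(m'))^{n-k}`** for `f ≥ 0` (union bound over the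
`k`-subsets of the quartic entries; each fixes `k` factors `f(2)` and frees the rest). [folklore] -/
private theorem sum_piFinset_indicator_prod_le_choose {n : ℕ} (degs : Finset ℕ) (f : ℕ → ℝ) (hf : ∀ m, 0 ≤ f m) (k : ℕ) :
    ∑ δ ∈ Fintype.piFinset (fun _ : Fin n => degs),
        (if k ≤ (univ.filter fun a => δ a = 2).card then ∏ a, f (δ a) else 0) ≤
      (n.choose k : ℝ) * (f 2 ^ k * (∑ m ∈ degs, f m) ^ (n - k)) := by
  classical
  set F : ℝ := ∑ m ∈ degs, f m with hF
  have hF0 : 0 ≤ F := sum_nonneg fun m _ => hf m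
  -- (1) the indicator is at most the number of `k`-subsets of the quartic entries
  have h1 : ∀ δ : Fin n → ℕ, (if k ≤ (univ.filter fun a => δ a = 2).card then ∏ a, f (δ a) else 0) ≤
      ∑ S ∈ (powersetCard k (univ : Finset (Fin n))).filter (fun S => S ⊆ univ.filter fun a => δ a = 2), ∏ a, f (δ a) := by
    intro δ
    have hP : 0 ≤ ∏ a, f (δ a) := prod_nonneg fun a _ => hf _
    split_ifs with hk
    · rw [sum_const, nsmul_eq_mul]
      have hcard : 1 ≤ ((powersetCard k (univ : Finset (Fin n))).filter (fun S => S ⊆ univ.filter fun a => δ a = 2)).card := by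
        have heq : (powersetCard k (univ : Finset (Fin n))).filter (fun S => S ⊆ univ.filter fun a => δ a = 2) =
            powersetCard k (univ.filter fun a => δ a = 2) := by
          ext S
          simp only [mem_filter, mem_powersetCard, subset_univ, true_and]
          tauto
        rw [heq, card_powersetCard]
        exact Nat.choose_pos hk
      calc ∏ a, f (δ a) = 1 * ∏ a, f (δ a) := (one_mul _).symm
        _ ≤ _ := mul_le_mul_of_nonneg_right (by exact_mod_cast hcard) hP
    · exact sum_nonneg fun S _ => hP
  -- (2) swap the sums; the inner sum over assignments factorises
  have h2 : ∀ S ∈ powersetCard k (univ : Finset (Fin n)),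
      ∑ δ ∈ Fintype.piFinset (fun _ : Fin n => degs), (if S ⊆ univ.filter (fun a => δ a = 2) then ∏ a, f (δ a) else 0) ≤
        f 2 ^ k * F ^ (n - k) := by
    intro S hS
    have hSk : S.card = k := (mem_powersetCard.1 hS).2
    set g : Fin n → ℕ → ℝ := fun a m => if a ∈ S then (if m = 2 then f m else 0) else f m with hg
    have hpt : ∀ δ : Fin n → ℕ, (if S ⊆ univ.filter (fun a => δ a = 2) then ∏ a, f (δ a) else 0) = ∏ a, g a (δ a) := by
      intro δ
      split_ifs with hsub
      · refine prod_congr rfl fun a _ => ?_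
        rw [hg]; dsimp only
        by_cases ha : a ∈ S
        · have : δ a = 2 := (mem_filter.1 (hsub ha)).2
          rw [if_pos ha, if_pos this]
        · rw [if_neg ha]
      · -- some `a ∈ S` has `δ a ≠ 2`, so the product vanishes
        obtain ⟨a, haS, ha2⟩ : ∃ a ∈ S, δ a ≠ 2 := by
          by_contra hcon
          push Not at hcon
          exact hsub fun a ha => mem_filter.2 ⟨mem_univ _, hcon a ha⟩
        symm
        exact prod_eq_zero (mem_univ a) (by rw [hg]; dsimp only; rw [if_pos haS, if_neg ha2])
    rw [sum_congr rfl fun δ _ => hpt δ, sum_prod_piFinset]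
    -- `∏_a Σ_m g a m`: the factors with `a ∈ S` are `≤ f 2`, the others `= F`
    have hfac : ∀ a, ∑ m ∈ degs, g a m ≤ (if a ∈ S then f 2 else F) := by
      intro a
      by_cases ha : a ∈ S
      · simp only [hg, if_pos ha]
        rw [sum_ite_eq' degs 2]
        split_ifs
        · exact le_rfl
        · exact hf 2
      · simp only [hg, if_neg ha]
        exact le_rfl
    have hfac0 : ∀ a, 0 ≤ ∑ m ∈ degs, g a m := by
      intro a
      refine sum_nonneg fun m _ => ?_
      rw [hg]; dsimp only
      split_ifs <;> first | exact hf _ | exact le_rfl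
    calc ∏ a, ∑ m ∈ degs, g a m ≤ ∏ a : Fin n, (if a ∈ S then f 2 else F) :=
          prod_le_prod (fun a _ => hfac0 a) (fun a _ => hfac a)
      _ = f 2 ^ k * F ^ (n - k) := by
          rw [prod_ite, prod_const, prod_const]
          congr 2
          · rw [← hSk]
            congr 1
            ext a
            simp
          · rw [filter_not, card_sdiff_of_subset (filter_subset _ _), card_univ, Fintype.card_fin, ← hSk]
            congr 2
            ext a
            simp
  -- (3) assemble
  calc ∑ δ ∈ Fintype.piFinset (fun _ : Fin n => degs),
        (if k ≤ (univ.filter fun a => δ a = 2).card then ∏ a, f (δ a) else 0)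
      ≤ ∑ δ ∈ Fintype.piFinset (fun _ : Fin n => degs),
          ∑ S ∈ (powersetCard k (univ : Finset (Fin n))).filter (fun S => S ⊆ univ.filter fun a => δ a = 2), ∏ a, f (δ a) :=
        sum_le_sum fun δ _ => h1 δ
    _ = ∑ δ ∈ Fintype.piFinset (fun _ : Fin n => degs), ∑ S ∈ powersetCard k (univ : Finset (Fin n)),
          (if S ⊆ univ.filter (fun a => δ a = 2) then ∏ a, f (δ a) else 0) :=
        sum_congr rfl fun δ _ => sum_filter _ _
    _ = ∑ S ∈ powersetCard k (univ : Finset (Fin n)), ∑ δ ∈ Fintype.piFinset (fun _ : Fin n => degs),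
          (if S ⊆ univ.filter (fun a => δ a = 2) then ∏ a, f (δ a) else 0) := sum_comm
    _ ≤ ∑ _S ∈ powersetCard k (univ : Finset (Fin n)), f 2 ^ k * F ^ (n - k) := sum_le_sum h2
    _ = (n.choose k : ℝ) * (f 2 ^ k * F ^ (n - k)) := by
        rw [sum_const, card_powersetCard, card_univ, Fintype.card_fin, nsmul_eq_mul]

/-! ### §2 The bi-graded order-`n` bound -/

variable {𝕜 : Type*} [RCLike 𝕜] {Γ : Type u} [Fintype Γ] [DecidableEq Γ] {n : ℕ} (C : Matrix Γ Γ 𝕜)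

/-- **The bi-graded order-`n` bound** (BGM 2006, (2.13)–(2.14) with (2.77)–(2.80)): for an interaction with pinned norms `N(m')`
vanishing for `m' > 2` (kernels of degrees `≤ 4`), in output degree `2p`, one label pinned,
`Σ_{W : W_i = w} ‖kernel_{2p} 𝓔ᵀ_C(V; n)(W)‖ ≤ n!·ρ^{-2p} κ^{-2(n-1)} α^{n-1} eⁿ · C(n, p-1) · f₂^{p-1} · ‖V‖_h^{n-(p-1)}` with
`f₂ = (e²(κ+ρ))⁴ N(2)` and `‖V‖_h = Σ_{m' ∈ degs} (e²(κ+ρ))^{2m'} N(m')`: only degree assignments with at least `p - 1` quartic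
entries reach `2p` external legs. [cite: BenfattoGiulianiMastropietro2006, (2.13)-(2.14) and (2.77)-(2.80)] -/
theorem sum_norm_kernel_cumulantOf_le_biquartic_of_gramBounded {κ : ℝ} (hκ : 0 < κ) (hGB : IsGramBoundedR C κ)
    (degs : Finset ℕ) (K : (m' : ℕ) → (Fin (2 * m') → Γ) → 𝕜) (N : ℕ → ℝ) (hN0 : ∀ m', 0 ≤ N m')
    (hN : ∀ m' (j : Fin (2 * m')) (w : Γ), ∑ Y ∈ univ.filter (fun Y : Fin (2 * m') → Γ => Y j = w), ‖K m' Y‖ ≤ N m')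
    (hN2 : ∀ m', 2 < m' → N m' = 0)
    {α : ℝ} (hα : 0 < α) (hrow : ∀ X, ∑ Y, ‖C X Y‖ ≤ α) (hcol : ∀ Y, ∑ X, ‖C X Y‖ ≤ α) {ρ : ℝ} (hρ : 0 < ρ)
    (hn : 0 < n) {p : ℕ} (i : Fin (2 * p)) (w : Γ) :
    ∑ W ∈ univ.filter (fun W : Fin (2 * p) → Γ => W i = w),
        ‖kernel 𝕜 ((cumulantOf (fun k => evenGaussConv 𝕜 C (vertexOf 𝕜 degs K ^ k)) n : evenPart 𝕜 Γ) : GrassmannAlgebra 𝕜 Γ)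
          (2 * p) W‖ ≤
      (n.factorial : ℝ) * (ρ⁻¹ ^ (2 * p) * κ⁻¹ ^ (2 * (n - 1)) * (α ^ (n - 1) * Real.exp n)) *
        ((n.choose (p - 1) : ℝ) * (((Real.exp 2 * (κ + ρ)) ^ (2 * 2) * N 2) ^ (p - 1) *
          (∑ m' ∈ degs, (Real.exp 2 * (κ + ρ)) ^ (2 * m') * N m') ^ (n - (p - 1)))) := by
  have h := sum_norm_kernel_cumulantOf_le_of_gramBounded C hκ.le hGB degs K N hN0 hN hα.le hrow hcol
    (fun δ => (α * ((∑ a, (2 * δ a : ℝ)) + n))⁻¹) (fun δ => by positivity) hn i w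
  refine h.trans ?_
  set r : ℕ := 2 * p with hr
  set c : ℝ := ρ⁻¹ ^ r * κ⁻¹ ^ (2 * (n - 1)) * (((n - 1).factorial : ℝ) * α ^ (n - 1) * Real.exp n) with hc
  have hc0 : 0 ≤ c := by positivity
  set f : ℕ → ℝ := fun m' => (Real.exp 2 * (κ + ρ)) ^ (2 * m') * N m' with hf
  have hf0 : ∀ m', 0 ≤ f m' := fun m' => mul_nonneg (by positivity) (hN0 _)
  -- every degree assignment (verbatim from `…_le_pow_of_gramBounded`)
  have hterm : ∀ δ : Fin n → ℕ,
      (if r + 2 * (n - 1) ≤ ∑ a, 2 * δ a then cumulantBound n κ α ((α * ((∑ a, (2 * δ a : ℝ)) + n))⁻¹) N r δ else 0) ≤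
        c * ∏ a, f (δ a) := by
    intro δ
    have hP : 0 ≤ ∏ a, f (δ a) := prod_nonneg fun a _ => hf0 _
    split_ifs with hle
    · rw [cumulantBound]
      have hA := choose_mul_pow_le (N := ∑ a, 2 * δ a) (r := r) (m := 2 * (n - 1)) hle hκ hρ
      have hT := treeFactor_choice_le hn δ hα
      have hNprod : 0 ≤ ∏ a, N (δ a) := prod_nonneg fun a _ => hN0 _
      have hTnonneg : 0 ≤ ((α * ((∑ a, (2 * δ a : ℝ)) + n))⁻¹)⁻¹ ^ (n - 1) *
          ∏ ℓ : Sym2 (Fin n), (1 + (α * ((∑ a, (2 * δ a : ℝ)) + n))⁻¹ * (α * (pairDeg (fun a => 2 * δ a) ℓ : ℝ))) := by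
        have hs : 0 ≤ ∑ a, (2 * δ a : ℝ) := sum_nonneg fun a _ => by positivity
        exact mul_nonneg (by positivity) (prod_nonneg fun ℓ _ => by positivity)
      calc ((((r.factorial : ℝ))⁻¹ * ((∑ a, 2 * δ a).descFactorial r : ℝ)) * κ ^ ((∑ a, 2 * δ a) - (r + 2 * (n - 1))) * ∏ a, N (δ a)) *
            (((α * ((∑ a, (2 * δ a : ℝ)) + n))⁻¹)⁻¹ ^ (n - 1) *
              ∏ ℓ : Sym2 (Fin n), (1 + (α * ((∑ a, (2 * δ a : ℝ)) + n))⁻¹ * (α * (pairDeg (fun a => 2 * δ a) ℓ : ℝ))))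
          ≤ ((ρ⁻¹ ^ r * κ⁻¹ ^ (2 * (n - 1)) * (κ + ρ) ^ (∑ a, 2 * δ a)) * ∏ a, N (δ a)) *
              (((n - 1).factorial : ℝ) * α ^ (n - 1) * Real.exp (2 * (∑ a, (2 * δ a : ℝ)) + n)) :=
            mul_le_mul (mul_le_mul_of_nonneg_right hA hNprod) hT hTnonneg (by positivity)
        _ = c * ∏ a, f (δ a) := by
            have hexp : Real.exp (2 * (∑ a, (2 * δ a : ℝ)) + n) = Real.exp n * ∏ a, Real.exp 2 ^ (2 * δ a) := by
              rw [Real.exp_add, mul_comm, mul_sum, Real.exp_sum]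
              congr 1
              refine prod_congr rfl fun a _ => ?_
              rw [← Real.exp_nat_mul]
              congr 1
              push_cast
              ring
            rw [hexp, ← prod_pow_eq_pow_sum, hc, hf]
            simp only [mul_pow, prod_mul_distrib]
            ring
    · exact mul_nonneg hc0 hP
  -- the bi-grading: assignments with fewer than `p - 1` quartic entries do not reach degree `2p`
  have hterm' : ∀ δ : Fin n → ℕ,
      (if r + 2 * (n - 1) ≤ ∑ a, 2 * δ a then cumulantBound n κ α ((α * ((∑ a, (2 * δ a : ℝ)) + n))⁻¹) N r δ else 0) ≤
        c * (if p - 1 ≤ (univ.filter fun a => δ a = 2).card then ∏ a, f (δ a) else 0) := by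
    intro δ
    have hP : 0 ≤ ∏ a, f (δ a) := prod_nonneg fun a _ => hf0 _
    by_cases hq : p - 1 ≤ (univ.filter fun a => δ a = 2).card
    · rw [if_pos hq]; exact hterm δ
    rw [if_neg hq, mul_zero]
    split_ifs with hle
    · -- some entry exceeds `2`, so the product of the `f`'s vanishes
      have hex : ∃ a, 2 < δ a := by
        by_contra hcon
        push Not at hcon
        have hs := sum_two_mul_le_of_le_two δ hcon
        omega
      obtain ⟨a, ha⟩ := hex
      have hzero : ∏ a, f (δ a) = 0 :=
        prod_eq_zero (mem_univ a) (by rw [hf]; dsimp only; rw [hN2 _ ha, mul_zero])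
      have h' := hterm δ
      rw [if_pos hle, hzero, mul_zero] at h'
      exact h'
    · exact le_rfl
  -- sum over the degree assignments
  have hcomb := sum_piFinset_indicator_prod_le_choose (n := n) degs f hf0 (p - 1)
  have hf2 : f 2 = (Real.exp 2 * (κ + ρ)) ^ (2 * 2) * N 2 := rfl
  calc (n : ℝ) * ∑ δ ∈ Fintype.piFinset (fun _ : Fin n => degs),
          (if r + 2 * (n - 1) ≤ ∑ a, 2 * δ a then cumulantBound n κ α ((α * ((∑ a, (2 * δ a : ℝ)) + n))⁻¹) N r δ else 0)
      ≤ (n : ℝ) * ∑ δ ∈ Fintype.piFinset (fun _ : Fin n => degs),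
          c * (if p - 1 ≤ (univ.filter fun a => δ a = 2).card then ∏ a, f (δ a) else 0) :=
        mul_le_mul_of_nonneg_left (sum_le_sum fun δ _ => hterm' δ) (Nat.cast_nonneg n)
    _ = (n : ℝ) * c * ∑ δ ∈ Fintype.piFinset (fun _ : Fin n => degs),
          (if p - 1 ≤ (univ.filter fun a => δ a = 2).card then ∏ a, f (δ a) else 0) := by rw [← mul_sum, hc]; ring
    _ ≤ (n : ℝ) * c * ((n.choose (p - 1) : ℝ) * (f 2 ^ (p - 1) * (∑ m ∈ degs, f m) ^ (n - (p - 1)))) :=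
        mul_le_mul_of_nonneg_left hcomb (by positivity)
    _ = (n.factorial : ℝ) * (ρ⁻¹ ^ (2 * p) * κ⁻¹ ^ (2 * (n - 1)) * (α ^ (n - 1) * Real.exp n)) *
          ((n.choose (p - 1) : ℝ) * (((Real.exp 2 * (κ + ρ)) ^ (2 * 2) * N 2) ^ (p - 1) *
            (∑ m' ∈ degs, (Real.exp 2 * (κ + ρ)) ^ (2 * m') * N m') ^ (n - (p - 1)))) := by
        rw [← hf2, hc, hr, ← Nat.mul_factorial_pred (Nat.pos_iff_ne_zero.1 hn), Nat.cast_mul]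
        ring

end Literature.MathematicalPhysics.QuantumLattice

end
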